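import Mathlib
import Literature.Analysis.FluidPDE.LocalHelmholtzSupBound
import Summits.NavierStokesRegularity.NavierStokesRegularity.Theorems.ThreadingFluxCentreJetTriaxialRigidity
import Summits.NavierStokesRegularity.NavierStokesRegularity.Theorems.ThreadingFluxCentreJetPolhodeForcing
import HarnessLib

/-!
# Crux `PoloidalLiouville` (stmt-NavierStokesRegularity-1222, wall W1), crux idea «steady-centre-sieve» (ns-idea-15):
# ORDER DICHOTOMY at a zero-drift triaxial centre — irrotational on the ball, or a NON-ZERO polhode 2-jet

Support file (`--supports stmt-NavierStokesRegularity-1222`, helper; cell `ns-wall-extremal`, ns-wall-eng-7 g6, 0 kit).  By name from L1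
`CentreJet.triaxialToroidalJetRigidity` (p696348) and POLHODE FORCING `CentreJet.polhodeForcing_of` (p698618): for a real-analytic steady
Navier–Stokes flow on a ball, unthreaded about `x₀`, with `V(x₀) = 0` and a triaxial strain,
EITHER `curl V ≡ 0` on the whole ball, OR the vorticity 2-jet at `x₀` is `μ · y × DV(x₀)y` with `μ ≠ 0`
(`orderDichotomy`).  Ingredients beyond the two named theorems: the vanishing 1-jet gives `ΔV(x₀) = 0`
(`laplacian_centre_eq_zero`, via the tree's `curl curl = ∇div − Δ`), and a symmetric bilinear map with zero diagonal vanishes.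
So the degenerate-centre analysis of the steady stratum at a triaxial centre is EXACTLY the conjecture C1″ (`μ ≠ 0` cell).

HONEST FRAME: helper; C1″ / C1 / C1* untouched; `PoloidalLiouville` (1222) and NS regularity OPEN; W1 movement 0.
-/

-- the summit and its single sub-problem share the name (CONVENTIONS §1)
set_option linter.dupNamespace false

noncomputable section

namespace Summit.NavierStokesRegularity.NavierStokesRegularity.Theorems.PoloidalLiouville.CentreJet

open Set Function Filter Topology Metric
open scoped ContDiff RealInnerProductSpace
open Literature.Analysis.FluidPDE

/-- **`ΔV(x₀) = 0` at a zero-drift triaxial unthreaded steady analytic centre** (the vorticity 1-jet vanishes by polhode forcing, and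
`ΔV = ∇ div V − curl curl V`). -/
theorem laplacian_centre_eq_zero (V : E3 → E3) (p : E3 → ℝ) (x₀ : E3) (ρ : ℝ) (hρ : 0 < ρ)
    (hV : AnalyticOnNhd ℝ V (ball x₀ ρ)) (hp : AnalyticOnNhd ℝ p (ball x₀ ρ)) (hNS : IsSteadyNSOn (ball x₀ ρ) V p)
    (hun : ∀ x ∈ ball x₀ ρ, ⟪x - x₀, curl V x⟫ = 0) (hV0 : V x₀ = 0)
    (hframe : ∃ (u : Fin 3 → E3) (e : Fin 3 → ℝ), Orthonormal ℝ u ∧ Function.Injective e ∧ ∀ i, fderiv ℝ V x₀ (u i) = e i • u i) :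
    Laplacian.laplacian V x₀ = 0 := by
  have hD1 := (polhodeForcing_of V p x₀ ρ hρ hV hp hNS hun hV0 hframe).1
  have hball : ball x₀ ρ ∈ 𝓝 x₀ := ball_mem_nhds x₀ hρ
  obtain ⟨-, -, hdiv, -⟩ := hNS
  obtain ⟨W, hW, hWV⟩ := exists_contDiff_eventuallyEq_of_ball (n := 3) hρ (hV.contDiffOn_of_completeSpace.of_le le_top)
  have hW2 : ContDiff ℝ 2 W := hW.of_le (by norm_num)
  have hWV' := eventually_eventuallyEq_of_eventuallyEq hWV
  -- `div W = 0` near `x₀`, so its derivative vanishes at `x₀`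
  have hdivW : VectorCalculus.divergence W =ᶠ[𝓝 x₀] fun _ => (0 : ℝ) := by
    filter_upwards [hWV', hball] with z hz hzb
    rw [VectorCalculus.divergence, hz.fderiv_eq]
    exact hdiv z hzb
  have hDdiv : fderiv ℝ (VectorCalculus.divergence W) x₀ = 0 := by
    rw [hdivW.fderiv_eq]; simp
  -- `curl W = curl V` near `x₀`, so `D(curl W)(x₀) = 0` and `curl curl W (x₀) = 0`
  have hcurl : curl W =ᶠ[𝓝 x₀] curl V := by
    filter_upwards [hWV'] with z hz
    rw [curl_eq_curlCLM, curl_eq_curlCLM, hz.fderiv_eq]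
  have hcc : curl (curl W) x₀ = 0 := by
    rw [curl_eq_curlCLM, hcurl.fderiv_eq, hD1, map_zero]
  have h := curl_curl_eq_sum_fderiv_divergence_sub_laplacian hW2 x₀
  rw [hcc, hDdiv] at h
  simp only [zero_apply, zero_smul, Finset.sum_const_zero, zero_sub, zero_eq_neg] at h
  rw [(InnerProductSpace.laplacian_congr_nhds hWV).eq_of_nhds] at h
  exact h

/-- **Order dichotomy.**  At a zero-drift triaxial unthreaded steady analytic centre: either the flow is IRROTATIONAL on the whole ball, or
its vorticity 2-jet is a NON-ZERO multiple of the polhode field `y × DV(x₀) y` (the cell of the conjecture C1″). -/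
theorem orderDichotomy (V : E3 → E3) (p : E3 → ℝ) (x₀ : E3) (ρ : ℝ) (hρ : 0 < ρ)
    (hV : AnalyticOnNhd ℝ V (ball x₀ ρ)) (hp : AnalyticOnNhd ℝ p (ball x₀ ρ)) (hNS : IsSteadyNSOn (ball x₀ ρ) V p)
    (hun : ∀ x ∈ ball x₀ ρ, ⟪x - x₀, curl V x⟫ = 0) (hV0 : V x₀ = 0)
    (hframe : ∃ (u : Fin 3 → E3) (e : Fin 3 → ℝ), Orthonormal ℝ u ∧ Function.Injective e ∧ ∀ i, fderiv ℝ V x₀ (u i) = e i • u i) :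
    (∀ x ∈ ball x₀ ρ, curl V x = 0) ∨
      ∃ μ : ℝ, μ ≠ 0 ∧ ∀ y : E3, fderiv ℝ (fderiv ℝ (curl V)) x₀ y y = μ • cross y (fderiv ℝ V x₀ y) := by
  obtain ⟨-, μ, hμ⟩ := polhodeForcing_of V p x₀ ρ hρ hV hp hNS hun hV0 hframe
  by_cases hμ0 : μ = 0
  · left
    -- the 2-jet vanishes: zero diagonal + symmetry
    set B := fderiv ℝ (fderiv ℝ (curl V)) x₀ with hB
    have hdiag : ∀ y, B y y = 0 := fun y => by rw [hμ y, hμ0, zero_smul]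
    have hω : AnalyticOnNhd ℝ (curl V) (ball x₀ ρ) := analyticOnNhd_curl hV
    have hsymm : IsSymmSndFDerivAt ℝ (curl V) x₀ :=
      ((hω x₀ (mem_ball_self hρ)).contDiffAt (n := 2)).isSymmSndFDerivAt (by simp)
    have hB0 : fderiv ℝ (fderiv ℝ (curl V)) x₀ = 0 := by
      refine ContinuousLinearMap.ext fun y => ContinuousLinearMap.ext fun z => ?_
      show B y z = 0
      have h := hdiag (y + z)
      simp only [map_add, add_apply] at h
      rw [hdiag y, hdiag z, zero_add, add_zero, hsymm z y, ← two_smul ℝ (B y z)] at h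
      exact (smul_eq_zero.mp h).resolve_left two_ne_zero
    have hΔ := laplacian_centre_eq_zero V p x₀ ρ hρ hV hp hNS hun hV0 hframe
    exact triaxialToroidalJetRigidity V p x₀ ρ hρ hV hp hNS hun hV0 hΔ hframe hB0
  · right
    exact ⟨μ, hμ0, hμ⟩

end Summit.NavierStokesRegularity.NavierStokesRegularity.Theorems.PoloidalLiouville.CentreJet

end
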